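import Summits.CriticalPhenomena.PercolationContinuityZ3.Theorems.PercBurnResprinkleVacantReignitionFreshDominationAux
import HarnessLib

/-!
# Crux `PercBurnResprinkle.VacantReignition` (stmt-CriticalPhenomena-7203), line `strip-fresh-field-lss`,
# stub `stub_transport` — auxiliary file 1: the block refinement (rounding map, windows, dust slots)

Pure-theorem helper file (lead prover-line-stmt-CriticalPhenomena-7203-0, worker on `stub_transport`)
for the STAR-DUST BLOCK-REFINEMENT TRANSPORT, which derives the registered engine of the line,
`stub_noCagesFat : ∀ k ≥ 1, ∃ ρ_k < 1, ∀ L₀ ∃ L ≥ L₀ ∃ p > p_c, 0 < (μ ⊗ μ){block 0 percolates in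
{(L,k)-window-vacant ∧ dust ≤ ρ_k}}`, from its single-aspect case `k = 1` (hypothesis `E₁`).  The
transport refines a COARSE block lattice of spacing `b' = 2L'+1` (window radius `blockR L' 1 =
3b' - 1`) to a FINE block lattice of spacing `b = 2L+1`, `L = ⌊L'/(k+2)⌋` (window radius
`blockR L k = (k+2) b - k`), along the coordinatewise ROUNDING MAP `f(t) = ⌊(b' t + L)/b⌋`,
`y(a)_l = f(a_l)`: this file contains its deterministic combinatorics, stated for an abstract
`f : ℤ → ℤ` with the rounding property `|b f(t) - b' t| ≤ L` (`vacantReignition_tr_round` for the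
explicit map):

* `vacantReignition_tr_step_bounds`, `…_strictMono`, `…_f_zero`, `…_step_le`, `…_repr_unique` —
  `b' - 2L ≤ b (f(t+1) - f(t)) ≤ b' + 2L`, so `f` is strictly increasing with steps `≤ M` once
  `b' + 2L < (M+1) b`, `f(0) = 0`, and every integer is uniquely `f(t) + u`, `0 ≤ u < f(t+1) - f(t)`;
* `vacantReignition_tr_window` — WINDOW CONTAINMENT: if `2L + L' + R ≤ R'`, the fine window
  `b (y(a) + j eᵢ) + B(R)` of every fine block on the straight segment from `y(a)` to
  `y(a + eᵢ) = y(a) + (f(aᵢ+1) - f(aᵢ)) eᵢ` lies in the coarse window `b' a + B(R')` (near half) or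
  `b' (a + eᵢ) + B(R')` (far half), so coarse vacancy of both ends gives fine vacancy of the segment;
* `vacantReignition_tr_slot_cover`, `…_slot_injective` — the DUST SLOTS `σ(a, i, j)`, `i ∈ Fin 3`,
  `j < M`, of a coarse block `a`: slot `(i, j)` carries the dust edge `{b z, b z + e₀}` of the fine
  block `z = y(a) + j eᵢ` when `j < f(aᵢ+1) - f(aᵢ)` and (`j ≥ 1` or `i = 0`), and otherwise the
  padding edge `{b y(a) + c e₁, b y(a) + (c+1) e₁}`, `c = 3j + i + 1 ≤ 3M < b`; every fine block of
  the three forward segments of `a` (ends excluded) is carried by a slot of `a`, and distinct slots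
  carry distinct edges (the fine skeleton is a subdivision of the coarse lattice: unique
  representation along `f`), which makes the slot events of distinct coarse blocks independent
  with the same marginals in the companion files.

No definitions; all names are prefixed `vacantReignition_tr_`.  The refinement is the elementary
"renormalise the renormalised lattice" bookkeeping of static block arguments (Grimmett 1999, §7.4,
block construction p. 178–181), written out for non-commensurable spacings.

## References

* G. Grimmett, *Percolation*, 2nd ed., Springer 1999, §7.4 pp. 178–181 [GrimmettPercolation1999].
-/

noncomputable section

namespace Summit.CriticalPhenomena.PercolationContinuityZ3.Theorems

open MeasureTheory ProbabilityTheory Literature.Probability.Percolation Literature.Probability.LatticeModels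

/-! ### The rounding map: one-dimensional arithmetic -/

/-- Step bounds of a rounding map `f` with `|b f(t) - b' t| ≤ L` (`b = 2L+1`, `b' = 2L'+1`):
`b' - 2L ≤ b (f(t+1) - f(t)) ≤ b' + 2L`. [folklore] -/
theorem vacantReignition_tr_step_bounds {L L' : ℕ} {f : ℤ → ℤ}
    (hf : ∀ t : ℤ, |((2 * L + 1 : ℕ) : ℤ) * f t - ((2 * L' + 1 : ℕ) : ℤ) * t| ≤ L) (t : ℤ) :
    ((2 * L' + 1 : ℕ) : ℤ) - 2 * L ≤ ((2 * L + 1 : ℕ) : ℤ) * (f (t + 1) - f t) ∧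
      ((2 * L + 1 : ℕ) : ℤ) * (f (t + 1) - f t) ≤ ((2 * L' + 1 : ℕ) : ℤ) + 2 * L := by
  have h1 := hf t
  have h2 := hf (t + 1)
  rw [abs_le] at h1 h2
  obtain ⟨h1l, h1r⟩ := h1
  obtain ⟨h2l, h2r⟩ := h2
  push_cast at h1l h1r h2l h2r ⊢
  constructor <;> nlinarith [h1l, h1r, h2l, h2r]

/-- A rounding map is strictly increasing as soon as `L ≤ L'` (each step is `≥ (b' - 2L)/b > 0`).
[folklore] -/
theorem vacantReignition_tr_strictMono {L L' : ℕ} {f : ℤ → ℤ}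
    (hf : ∀ t : ℤ, |((2 * L + 1 : ℕ) : ℤ) * f t - ((2 * L' + 1 : ℕ) : ℤ) * t| ≤ L) (hLL' : L ≤ L') :
    StrictMono f := by
  refine strictMono_int_of_lt_succ fun t => ?_
  have h := (vacantReignition_tr_step_bounds hf t).1
  push_cast at h
  have hL : (L : ℤ) ≤ L' := by exact_mod_cast hLL'
  nlinarith [h, hL]

/-- A rounding map fixes the origin: `|b f(0)| ≤ L < b` forces `f 0 = 0`. [folklore] -/
theorem vacantReignition_tr_f_zero {L L' : ℕ} {f : ℤ → ℤ}
    (hf : ∀ t : ℤ, |((2 * L + 1 : ℕ) : ℤ) * f t - ((2 * L' + 1 : ℕ) : ℤ) * t| ≤ L) : f 0 = 0 := by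
  have h := hf 0
  rw [mul_zero, sub_zero, abs_le] at h
  push_cast at h
  obtain ⟨h1, h2⟩ := h
  rcases lt_trichotomy (f 0) 0 with h0 | h0 | h0
  · nlinarith
  · exact h0
  · nlinarith

/-- The steps of a rounding map are at most `M` once `b' + 2L < (M+1) b`. [folklore] -/
theorem vacantReignition_tr_step_le {L L' M : ℕ} {f : ℤ → ℤ}
    (hf : ∀ t : ℤ, |((2 * L + 1 : ℕ) : ℤ) * f t - ((2 * L' + 1 : ℕ) : ℤ) * t| ≤ L)
    (hM : 2 * L' + 1 + 2 * L < (M + 1) * (2 * L + 1)) (t : ℤ) : f (t + 1) - f t ≤ M := by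
  have h := (vacantReignition_tr_step_bounds hf t).2
  push_cast at h
  have hM' : (2 * L' + 1 + 2 * L : ℤ) < (M + 1) * (2 * L + 1) := by exact_mod_cast hM
  have hlt : (2 * L + 1 : ℤ) * (f (t + 1) - f t) < (2 * L + 1 : ℤ) * (M + 1) := by nlinarith
  have := lt_of_mul_lt_mul_left hlt (by positivity)
  omega

/-- **Unique representation** along a strictly increasing `f : ℤ → ℤ`: `f t + u = f t' + u'` with
`0 ≤ u < f(t+1) - f(t)` and `0 ≤ u' < f(t'+1) - f(t')` forces `t = t'` and `u = u'`. [folklore] -/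
theorem vacantReignition_tr_repr_unique {f : ℤ → ℤ} (hmono : StrictMono f) {t t' u u' : ℤ}
    (h : f t + u = f t' + u') (hu : 0 ≤ u) (hu' : 0 ≤ u') (hut : u < f (t + 1) - f t)
    (hut' : u' < f (t' + 1) - f t') : t = t' ∧ u = u' := by
  rcases lt_trichotomy t t' with hlt | rfl | hgt
  · have : f (t + 1) ≤ f t' := hmono.monotone (by omega)
    exact absurd h (by omega)
  · exact ⟨rfl, by omega⟩
  · have : f (t' + 1) ≤ f t := hmono.monotone (by omega)
    exact absurd h (by omega)

/-- The explicit rounding map `t ↦ ⌊(b' t + L) / b⌋` satisfies `|b f(t) - b' t| ≤ L`. [folklore] -/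
theorem vacantReignition_tr_round (L L' : ℕ) (t : ℤ) :
    |((2 * L + 1 : ℕ) : ℤ) * ((((2 * L' + 1 : ℕ) : ℤ) * t + L) / ((2 * L + 1 : ℕ) : ℤ)) -
      ((2 * L' + 1 : ℕ) : ℤ) * t| ≤ L := by
  set b : ℤ := ((2 * L + 1 : ℕ) : ℤ) with hb
  set a : ℤ := ((2 * L' + 1 : ℕ) : ℤ) * t + L with ha
  have hb0 : 0 < b := by rw [hb]; positivity
  have h1 := Int.mul_ediv_add_emod a b
  have h2 := Int.emod_nonneg a hb0.ne'
  have h3 := Int.emod_lt_of_pos a hb0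
  have hbL : b = 2 * L + 1 := by rw [hb]; push_cast; ring
  rw [abs_le]
  constructor <;> omega

/-! ### Window containment (fine vacancy from coarse vacancy) -/

/-- **Window transfer.** For a rounding map `f` (`|b f(t) - b' t| ≤ L`) with block map
`y(a)_l = f(a_l)` and radii with `2L + L' + R ≤ R'`: every point of the fine window
`b (y(a) + j eᵢ) + B(R)`, `0 ≤ j ≤ f(aᵢ+1) - f(aᵢ)`, lies in the coarse window `b' a + B(R')` (if
`2j ≤ f(aᵢ+1) - f(aᵢ)`) or in `b' (a + eᵢ) + B(R')` (otherwise); hence a property of all points of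
both coarse windows holds at all points of the fine window. [folklore] -/
theorem vacantReignition_tr_window : ∀ {L L' R R' : ℕ} {f : ℤ → ℤ},
    (∀ t : ℤ, |((2 * L + 1 : ℕ) : ℤ) * f t - ((2 * L' + 1 : ℕ) : ℤ) * t| ≤ L) →
    2 * L + L' + R ≤ R' → ∀ (y : (Fin 3 → ℤ) → (Fin 3 → ℤ)), (∀ a l, y a l = f (a l)) →
    ∀ (a : Fin 3 → ℤ) (i : Fin 3) (j : ℕ), (j : ℤ) ≤ f (a i + 1) - f (a i) →
    ∀ (Q : (Fin 3 → ℤ) → Prop),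
    (∀ w ∈ (↑(box 3 R') : Set (Fin 3 → ℤ)), Q (((2 * L' + 1 : ℕ) : ℤ) • a + w)) →
    (∀ w ∈ (↑(box 3 R') : Set (Fin 3 → ℤ)), Q (((2 * L' + 1 : ℕ) : ℤ) • (a + Pi.single i 1) + w)) →
    ∀ w ∈ (↑(box 3 R) : Set (Fin 3 → ℤ)), Q (((2 * L + 1 : ℕ) : ℤ) • (y a + Pi.single i (j : ℤ)) + w) := by
  intro L L' R R' f hf hR y hy a i j hjn Q hQa hQb w hw
  rw [Finset.mem_coe, mem_box] at hw
  have hst := vacantReignition_tr_step_bounds hf (a i)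
  have hR' : (2 * L + L' + R : ℤ) ≤ R' := by exact_mod_cast hR
  by_cases hnear : 2 * (j : ℤ) ≤ f (a i + 1) - f (a i)
  · -- near half: the window of `a`
    have heq : ((2 * L' + 1 : ℕ) : ℤ) • a +
        (((2 * L + 1 : ℕ) : ℤ) • (y a + Pi.single i (j : ℤ)) + w - ((2 * L' + 1 : ℕ) : ℤ) • a) =
        ((2 * L + 1 : ℕ) : ℤ) • (y a + Pi.single i (j : ℤ)) + w := by abel
    rw [← heq]
    refine hQa _ ?_
    rw [Finset.mem_coe, mem_box]
    intro l
    have hfl := hf (a l)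
    rw [abs_le] at hfl
    have hwl := hw l
    simp only [Pi.add_apply, Pi.sub_apply, Pi.smul_apply, smul_eq_mul, hy]
    by_cases hl : l = i
    · subst hl
      rw [Pi.single_eq_same]
      have h2 : 2 * (((2 * L + 1 : ℕ) : ℤ) * (j : ℤ)) ≤ 2 * (L' + L) + 1 := by
        have := hst.2
        push_cast at this hnear ⊢
        nlinarith
      have hbj : ((2 * L + 1 : ℕ) : ℤ) * (j : ℤ) ≤ L' + L := by omega
      constructor <;> nlinarith [hfl.1, hfl.2, hwl.1, hwl.2, hbj, hR']
    · rw [Pi.single_eq_of_ne hl, add_zero]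
      constructor <;> nlinarith [hfl.1, hfl.2, hwl.1, hwl.2, hR']
  · -- far half: the window of `a + eᵢ`
    push Not at hnear
    have heq : ((2 * L' + 1 : ℕ) : ℤ) • (a + Pi.single i 1) +
        (((2 * L + 1 : ℕ) : ℤ) • (y a + Pi.single i (j : ℤ)) + w - ((2 * L' + 1 : ℕ) : ℤ) • (a + Pi.single i 1)) =
        ((2 * L + 1 : ℕ) : ℤ) • (y a + Pi.single i (j : ℤ)) + w := by abel
    rw [← heq]
    refine hQb _ ?_
    rw [Finset.mem_coe, mem_box]
    intro l
    have hwl := hw l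
    simp only [Pi.add_apply, Pi.sub_apply, Pi.smul_apply, smul_eq_mul, hy]
    by_cases hl : l = i
    · subst hl
      rw [Pi.single_eq_same, Pi.single_eq_same]
      have hfl := hf (a l + 1)
      rw [abs_le] at hfl
      -- `b (n - j) ≤ L'` where `n = f(a l + 1) - f(a l)`
      have h2 : 2 * (((2 * L + 1 : ℕ) : ℤ) * (f (a l + 1) - f (a l) - j)) ≤ 2 * L' := by
        have := hst.2
        push_cast at this hnear ⊢
        nlinarith
      have hbj : ((2 * L + 1 : ℕ) : ℤ) * (f (a l + 1) - f (a l) - j) ≤ L' := by omega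
      have hj0 : 0 ≤ ((2 * L + 1 : ℕ) : ℤ) * (f (a l + 1) - f (a l) - j) := by
        apply mul_nonneg (by positivity); omega
      constructor <;> nlinarith [hfl.1, hfl.2, hwl.1, hwl.2, hbj, hj0, hR']
    · rw [Pi.single_eq_of_ne hl, Pi.single_eq_of_ne hl, add_zero, add_zero]
      have hfl := hf (a l)
      rw [abs_le] at hfl
      constructor <;> nlinarith [hfl.1, hfl.2, hwl.1, hwl.2, hR']

/-! ### The dust slots of a coarse block: coverage and injectivity -/

/-- **Slot coverage.** With the slot map `σ` (slot `(i, j)` of the coarse block `a` carries the dust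
edge of the fine block `y(a) + j eᵢ` when `0 ≤ j < f(aᵢ+1) - f(aᵢ)` and (`j ≥ 1` or `i = 0`), and a
padding edge in direction `e₁` otherwise), every fine block `y(a) + j eᵢ`, `0 ≤ j < f(aᵢ+1) - f(aᵢ)`,
has its dust edge carried by some slot `(i', j')`, `j' < M`, of `a`. [folklore] -/
theorem vacantReignition_tr_slot_cover {L L' M : ℕ} {f : ℤ → ℤ}
    (hf : ∀ t : ℤ, |((2 * L + 1 : ℕ) : ℤ) * f t - ((2 * L' + 1 : ℕ) : ℤ) * t| ≤ L) (hLL' : L ≤ L')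
    (hM : 2 * L' + 1 + 2 * L < (M + 1) * (2 * L + 1))
    (y : (Fin 3 → ℤ) → (Fin 3 → ℤ))
    (σ : (Fin 3 → ℤ) → Fin 3 → ℕ → Sym2 (Fin 3 → ℤ))
    (hσ : ∀ a i j, σ a i j =
      if (1 ≤ j ∨ i = 0) ∧ (j : ℤ) < f (a i + 1) - f (a i) then
        s(((2 * L + 1 : ℕ) : ℤ) • (y a + Pi.single i (j : ℤ)),
          ((2 * L + 1 : ℕ) : ℤ) • (y a + Pi.single i (j : ℤ)) + Pi.single 0 1)
      else
        s(((2 * L + 1 : ℕ) : ℤ) • y a + Pi.single 1 ((3 * j + (i : ℕ) + 1 : ℕ) : ℤ),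
          ((2 * L + 1 : ℕ) : ℤ) • y a + Pi.single 1 ((3 * j + (i : ℕ) + 1 : ℕ) : ℤ) + Pi.single 1 1))
    (a : Fin 3 → ℤ) (i : Fin 3) (j : ℕ) (hj : (j : ℤ) < f (a i + 1) - f (a i)) :
    ∃ (i' : Fin 3) (j' : ℕ), j' < M ∧ σ a i' j' =
      s(((2 * L + 1 : ℕ) : ℤ) • (y a + Pi.single i (j : ℤ)),
        ((2 * L + 1 : ℕ) : ℤ) • (y a + Pi.single i (j : ℤ)) + Pi.single 0 1) := by
  have hmono := vacantReignition_tr_strictMono hf hLL'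
  by_cases h1 : 1 ≤ j
  · refine ⟨i, j, ?_, by rw [hσ, if_pos ⟨Or.inl h1, hj⟩]⟩
    have := vacantReignition_tr_step_le hf hM (a i)
    omega
  · obtain rfl : j = 0 := by omega
    have hM0 : 0 < M := by
      rcases Nat.eq_zero_or_pos M with h | h
      · subst h; omega
      · exact h
    refine ⟨0, 0, hM0, ?_⟩
    rw [hσ, if_pos ⟨Or.inr rfl, by exact_mod_cast sub_pos.2 (hmono (lt_add_one (a 0)))⟩]
    simp only [Nat.cast_zero, Pi.single_zero, add_zero]

/-- **Slot injectivity.** Distinct slots `(a, i, j)`, `j < M`, carry distinct edges, provided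
`L ≤ L'` (so `f` is strictly increasing) and `3M ≤ 2L` (the padding labels `3j + i + 1 ≤ 3M` are
`< b`): two dust slots with the same edge sit at the same fine block, whose coordinates
`f(a_l) + j [l = i]` determine `a`, `i`, `j` by unique representation along `f`; a dust edge
(direction `e₀`) is never a padding edge (direction `e₁`); two padding edges with the same edge
have `b y(a) + c e₁ = b y(a') + c' e₁` with `|c - c'| < b`, forcing `y(a) = y(a')` and `c = c'`.
[folklore] -/
theorem vacantReignition_tr_slot_injective {L L' M : ℕ} {f : ℤ → ℤ}
    (hf : ∀ t : ℤ, |((2 * L + 1 : ℕ) : ℤ) * f t - ((2 * L' + 1 : ℕ) : ℤ) * t| ≤ L) (hLL' : L ≤ L')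
    (hML : 3 * M ≤ 2 * L)
    (y : (Fin 3 → ℤ) → (Fin 3 → ℤ)) (hy : ∀ a l, y a l = f (a l))
    (σ : (Fin 3 → ℤ) → Fin 3 → ℕ → Sym2 (Fin 3 → ℤ))
    (hσ : ∀ a i j, σ a i j =
      if (1 ≤ j ∨ i = 0) ∧ (j : ℤ) < f (a i + 1) - f (a i) then
        s(((2 * L + 1 : ℕ) : ℤ) • (y a + Pi.single i (j : ℤ)),
          ((2 * L + 1 : ℕ) : ℤ) • (y a + Pi.single i (j : ℤ)) + Pi.single 0 1)
      else
        s(((2 * L + 1 : ℕ) : ℤ) • y a + Pi.single 1 ((3 * j + (i : ℕ) + 1 : ℕ) : ℤ),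
          ((2 * L + 1 : ℕ) : ℤ) • y a + Pi.single 1 ((3 * j + (i : ℕ) + 1 : ℕ) : ℤ) + Pi.single 1 1))
    {a a' : Fin 3 → ℤ} {i i' : Fin 3} {j j' : ℕ} (hjM : j < M) (hjM' : j' < M)
    (h : σ a i j = σ a' i' j') : a = a' ∧ i = i' ∧ j = j' := by
  have hmono := vacantReignition_tr_strictMono hf hLL'
  set N : ℤ := ((2 * L + 1 : ℕ) : ℤ) with hN
  have hN0 : (0 : ℤ) < N := by rw [hN]; positivity
  -- a dust edge (direction `e₀`) is never a padding edge (direction `e₁`)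
  have hne : ∀ z q : Fin 3 → ℤ, s(N • z, N • z + Pi.single 0 1) ≠ s(q, q + Pi.single 1 1) := by
    intro z q he
    rcases Sym2.eq_iff.1 he with ⟨h1, h2⟩ | ⟨h1, h2⟩
    · have e := congrFun h2 0
      rw [h1] at e
      simp at e
    · have e := congrFun h1 0
      rw [← h2] at e
      simp at e
  rw [hσ, hσ] at h
  split_ifs at h with hc hc'
  · -- dust / dust
    have hz : y a + Pi.single i (j : ℤ) = y a' + Pi.single i' (j' : ℤ) :=
      vacantReignition_dom_dustEdge_injective L h
    have hl : ∀ l, a l = a' l ∧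
        (Pi.single i (j : ℤ) : Fin 3 → ℤ) l = (Pi.single i' (j' : ℤ) : Fin 3 → ℤ) l := by
      intro l
      have e := congrFun hz l
      simp only [Pi.add_apply, hy] at e
      refine vacantReignition_tr_repr_unique hmono e ?_ ?_ ?_ ?_
      · simp only [Pi.single_apply]; split_ifs <;> positivity
      · simp only [Pi.single_apply]; split_ifs <;> positivity
      · by_cases hli : l = i
        · subst hli; rw [Pi.single_eq_same]; exact hc.2
        · rw [Pi.single_eq_of_ne hli]; exact sub_pos.2 (hmono (lt_add_one _))
      · by_cases hli : l = i'
        · subst hli; rw [Pi.single_eq_same]; exact hc'.2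
        · rw [Pi.single_eq_of_ne hli]; exact sub_pos.2 (hmono (lt_add_one _))
    refine ⟨funext fun l => (hl l).1, ?_⟩
    by_cases hii : i = i'
    · subst hii
      have e := (hl i).2
      rw [Pi.single_eq_same, Pi.single_eq_same] at e
      exact ⟨rfl, by exact_mod_cast e⟩
    · exfalso
      have e1 := (hl i).2
      have e2 := (hl i').2
      rw [Pi.single_eq_same, Pi.single_eq_of_ne hii] at e1
      rw [Pi.single_eq_of_ne (Ne.symm hii), Pi.single_eq_same] at e2
      have hj0 : j = 0 := by exact_mod_cast e1
      have hj0' : j' = 0 := by exact_mod_cast e2.symm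
      rcases hc.1 with h3 | h3
      · omega
      rcases hc'.1 with h4 | h4
      · omega
      exact hii (h3.trans h4.symm)
  · exact absurd h (hne _ _)
  · exact absurd h.symm (hne _ _)
  · -- pad / pad
    rcases Sym2.eq_iff.1 h with ⟨h1, -⟩ | ⟨h1, h2⟩
    swap
    · exfalso
      have e1 := congrFun h1 1
      have e2 := congrFun h2 1
      simp only [Pi.add_apply, Pi.single_eq_same] at e1 e2
      omega
    have hc3 : 3 * j + (i : ℕ) + 1 ≤ 3 * M := by have := i.isLt; omega
    have hc3' : 3 * j' + (i' : ℕ) + 1 ≤ 3 * M := by have := i'.isLt; omega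
    have hl1 := congrFun h1 1
    simp only [Pi.add_apply, Pi.smul_apply, smul_eq_mul, Pi.single_eq_same, hy] at hl1
    -- `N (f (a 1) - f (a' 1)) = c' - c` with `|c' - c| < N`
    have hML' : (3 * M : ℤ) ≤ 2 * L := by exact_mod_cast hML
    have hc3i : ((3 * j + (i : ℕ) + 1 : ℕ) : ℤ) ≤ 3 * M := by exact_mod_cast hc3
    have hc3i' : ((3 * j' + (i' : ℕ) + 1 : ℕ) : ℤ) ≤ 3 * M := by exact_mod_cast hc3'
    have hc1 : (1 : ℤ) ≤ ((3 * j + (i : ℕ) + 1 : ℕ) : ℤ) := by exact_mod_cast Nat.succ_pos _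
    have hc1' : (1 : ℤ) ≤ ((3 * j' + (i' : ℕ) + 1 : ℕ) : ℤ) := by exact_mod_cast Nat.succ_pos _
    have hNL : N = 2 * L + 1 := by rw [hN]; push_cast; ring
    rw [hNL] at hl1
    have hD : f (a 1) = f (a' 1) := by
      rcases lt_trichotomy (f (a 1) - f (a' 1)) 0 with hlt | heq | hgt
      · exfalso
        have h5 : (2 * (L : ℤ) + 1) * (f (a 1) - f (a' 1)) ≤ (2 * (L : ℤ) + 1) * (-1) :=
          mul_le_mul_of_nonneg_left (by omega) (by positivity)
        nlinarith [h5, hl1, hML', hc3i, hc3i', hc1, hc1']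
      · omega
      · exfalso
        have h5 : (2 * (L : ℤ) + 1) * 1 ≤ (2 * (L : ℤ) + 1) * (f (a 1) - f (a' 1)) :=
          mul_le_mul_of_nonneg_left (by omega) (by positivity)
        nlinarith [h5, hl1, hML', hc3i, hc3i', hc1, hc1']
    have hcc : 3 * j + (i : ℕ) + 1 = 3 * j' + (i' : ℕ) + 1 := by
      rw [hD] at hl1
      exact_mod_cast (add_left_cancel hl1 : (((3 * j + (i : ℕ) + 1 : ℕ)) : ℤ) = _)
    have hij : (i : ℕ) = i' ∧ j = j' := by have := i.isLt; have := i'.isLt; omega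
    refine ⟨funext fun l => hmono.injective ?_, Fin.ext hij.1, hij.2⟩
    by_cases hl : l = 1
    · subst hl; exact hD
    · have e := congrFun h1 l
      simp only [Pi.add_apply, Pi.smul_apply, smul_eq_mul, Pi.single_eq_of_ne hl, hy, add_zero] at e
      exact mul_left_cancel₀ hN0.ne' e

end Summit.CriticalPhenomena.PercolationContinuityZ3.Theorems

end
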